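import Summits.BirchSwinnertonDyer.Rank1Residual.Additive.CyclotomicGoodOrdinary
import Summits.BirchSwinnertonDyer.Rank1Residual.Additive.CyclotomicPrimeReduction
import Mathlib.RingTheory.Polynomial.RationalRoot
import HarnessLib

/-!
# The invariants `c₄`, `c₆` of the reduction `Ẽ_w`, up to fourth / sixth powers, from ANY factorisation
# of `c₄(E)`, `c₆(E)` in the completion (Silverman VII.1.3(b) without choosing a model)

HONEST FRAMING (cell `b2b-bsdres`, run/shared/lean/b2b/bsd-rank1-residual/, verbatim in every
file): the goal of the cell is to DELETE the COMBINATION-SHAPED residual classes of the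
Birch–Swinnerton-Dyer formula for ALL analytic-rank `≤ 1` elliptic curves over `ℚ` — "full BSD
formula for every rank `≤ 1` curve in class `C`" assembled STRICTLY from published theorems — so
that the rank-`≤ 1` remainder becomes exactly the CONSTRUCTION-SHAPED classes, which are TYPED
(missing-input `Prop`s), NOT attempted. This is not "finishing BSD". Sub-cell `additive-p2`
(X3♯(G-ord) / X4♯(G-ord)), generation 36, part 1: research route; no claim beyond the stated
classes; theorems only, no definition, no named fact, nothing booked, no label moved.

## What is proved (the local core of gen 34's LAW 4 "the special fibre over `F₀` is explicit")

Let `V/F` be an elliptic curve over a number field, `w` a finite place at which `V` has good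
reduction, `O = O_w`, `k = k_w`, and `Ẽ_w = V.reductionAt w` the reduction of Mathlib's CHOSEN local
minimal model `X = C • V_{F_w}` (`WeierstrassCurve.localMinimalModel`). The chosen model is only
determined up to an `O`-integral change of variables with unit `u` (Silverman VII.1.3(b)), so
`c₄(Ẽ_w)` is determined up to `(k^×)⁴` and `c₆(Ẽ_w)` up to `(k^×)⁶`; this file computes those classes
from the GLOBAL invariants WITHOUT constructing a model:

* `exists_reductionAt_c₄_eq_pow_four_mul` — if `c₄(Ẽ_w) ≠ 0` and `η·c₄(V) = s⁴·c` in `F_w` with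
  `η, c ∈ O`, `η ≡ 1`, `c ≢ 0 (mod 𝔪_w)`, then **`c₄(Ẽ_w) = t⁴·c̄` for some `t ∈ k^×`**: indeed
  `c₄(X) = u⁻⁴c₄(V)` is a `w`-unit, so `(s/u)⁴ = η·c₄(X)/c` is a unit of `O`, `s/u ∈ O^×` (`O` is
  integrally closed), `t = s/u mod 𝔪_w`;
* `exists_reductionAt_c₆_eq_pow_six_mul` — the same for `c₆` and sixth powers;
* `reductionAt_c₄_ne_zero_of_valuation_j_sub_lt_one` / `reductionAt_c₆_ne_zero_of_valuation_j_lt_one`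
  — the non-vanishing hypotheses at a place of residue characteristic `p ≥ 5` (`N(w) = p`):
  `w(j − 1728) < 1` ⟹ `j̃ = 1728` ⟹ `c₆(Ẽ_w) = 0`, `c₄(Ẽ_w)³ = 1728·Δ̃ ≠ 0`; `w(j) < 1` ⟹ `j̃ = 0` ⟹
  `c₄(Ẽ_w) = 0`, `c₆(Ẽ_w)² = −1728·Δ̃ ≠ 0`.

Parts 2–4 feed in the cyclotomic factorisation `(ζ_p − 1)^{p−1} = −p·η`, `η ≡ 1`, over `ℚ(ζ_p)`
and `c₄(E) = n·(−p)^v` / `c₆(E) = n·(−p)^v` (`p ∤ n`) on the (G)-cell, giving `c₄(Ẽ) = t⁴·n̄`,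
`c₆(Ẽ) = t⁶·n̄` — gen 34's LAW 4 (`α = −27c₄/(−p)^v`, `β = −54c₆/(−p)^v`) as a theorem over `ℚ(ζ_p)`.

References: J. H. Silverman, *AEC* VII.1 Prop. 1.3(b), VII.2, VII.5 Prop. 5.1(a), III.1 Table 3.1
(`c₄ ↦ u⁻⁴c₄`, `c₆ ↦ u⁻⁶c₆`).
-/

noncomputable section

open scoped Classical NumberField

open WeierstrassCurve IsDedekindDomain IsDedekindDomain.HeightOneSpectrum NumberField IsLocalRing
  Polynomial Literature.NumberTheory.EllipticCurves

namespace Summit.BirchSwinnertonDyer.Rank1Residual.Additive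

section Local

variable {F : Type} [Field F] [NumberField F] (V : WeierstrassCurve F) [V.IsElliptic]
  (w : HeightOneSpectrum (𝓞 F))

omit [V.IsElliptic] in
/-- **`c₄` of the reduction, up to fourth powers** (Silverman *AEC* VII.1.3(b): the minimal model is
unique up to `u ∈ O^×`, `c₄ ↦ u⁻⁴c₄`). Let `V/F` be good at `w` with `c₄(Ẽ_w) ≠ 0`, and suppose
`η·c₄(V) = s⁴·c` in `F_w` with `η, c ∈ O_w`, `η ≡ 1 (mod 𝔪_w)`, `c ≢ 0 (mod 𝔪_w)`. Then
**`c₄(Ẽ_w) = t⁴·c̄` for some `t ∈ k_w`, `t ≠ 0`.** [cite: SilvermanAEC2009, Prop. VII.1.3(b), p. 186] -/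
theorem exists_reductionAt_c₄_eq_pow_four_mul (hgood : V.HasGoodReductionAt w)
    (hc₄ : (V.reductionAt w).c₄ ≠ 0) {s : w.adicCompletion F}
    {η c : w.adicCompletionIntegers F} (hη : residue _ η = 1) (hc : residue _ c ≠ 0)
    (hfac : algebraMap _ (w.adicCompletion F) η * algebraMap F (w.adicCompletion F) V.c₄ =
      s ^ 4 * algebraMap _ (w.adicCompletion F) c) :
    ∃ t : ResidueField (w.adicCompletionIntegers F), t ≠ 0 ∧
      (V.reductionAt w).c₄ = t ^ 4 * residue _ c := by
  let O := w.adicCompletionIntegers F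
  let Fw := w.adicCompletion F
  have hg : (V.localMinimalModel w).HasGoodReduction O := hgood
  haveI := hg.toIsMinimal
  obtain ⟨C, hC⟩ : ∃ C : VariableChange Fw, C • V.baseChange Fw = V.localMinimalModel w := ⟨_, rfl⟩
  have hXc₄ : (V.localMinimalModel w).c₄ = (↑C.u⁻¹ : Fw) ^ 4 * algebraMap F Fw V.c₄ := by
    rw [← hC, variableChange_c₄, baseChange, map_c₄]
  have hIc : algebraMap O Fw ((V.localMinimalModel w).integralModel O).c₄ = (V.localMinimalModel w).c₄ :=
    integralModel_c₄_eq O _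
  have hred : (V.reductionAt w).c₄ = residue O ((V.localMinimalModel w).integralModel O).c₄ := by
    show (((V.localMinimalModel w).integralModel O).map (residue O)).c₄ = _
    rw [map_c₄]
  obtain ⟨cU, hcU⟩ : IsUnit c := by
    have h := hc
    rwa [Ne, residue_eq_zero_iff, mem_maximalIdeal, mem_nonunits_iff, not_not] at h
  -- `r = s / u` satisfies `r⁴ = η · c₄(X) · c⁻¹`
  have hr4 : (s * (↑C.u⁻¹ : Fw)) ^ 4 =
      algebraMap O Fw (η * ((V.localMinimalModel w).integralModel O).c₄ * ↑cU⁻¹) := by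
    have h1 : (s * (↑C.u⁻¹ : Fw)) ^ 4 * algebraMap O Fw c =
        algebraMap O Fw (η * ((V.localMinimalModel w).integralModel O).c₄) := by
      rw [map_mul, hIc, hXc₄]
      linear_combination (-(↑C.u⁻¹ : Fw) ^ 4) * hfac
    have hcc : c * ↑cU⁻¹ = 1 := by rw [← hcU, Units.mul_inv]
    calc (s * (↑C.u⁻¹ : Fw)) ^ 4 = (s * (↑C.u⁻¹ : Fw)) ^ 4 * algebraMap O Fw (c * ↑cU⁻¹) := by
          rw [hcc, map_one, mul_one]
      _ = _ := by rw [map_mul, ← mul_assoc, h1, ← map_mul]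
  -- `r` is integral over the integrally closed `O`, hence in `O`
  have hrint : IsIntegral O (s * (↑C.u⁻¹ : Fw)) := by
    refine ⟨Polynomial.X ^ 4 - Polynomial.C (η * ((V.localMinimalModel w).integralModel O).c₄ * ↑cU⁻¹),
      Polynomial.monic_X_pow_sub_C _ (by norm_num), ?_⟩
    rw [Polynomial.eval₂_sub, Polynomial.eval₂_X_pow, Polynomial.eval₂_C, hr4, sub_self]
  obtain ⟨y, hy⟩ := IsIntegrallyClosed.isIntegral_iff.mp hrint
  have hy4 : y ^ 4 = η * ((V.localMinimalModel w).integralModel O).c₄ * ↑cU⁻¹ :=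
    IsFractionRing.injective O Fw (by rw [map_pow, hy, hr4])
  have hres : residue O y ^ 4 =
      residue O ((V.localMinimalModel w).integralModel O).c₄ * residue O ↑cU⁻¹ := by
    rw [← map_pow, hy4, map_mul, map_mul, hη, one_mul]
  have hcinv : residue O c * residue O ↑cU⁻¹ = 1 := by
    rw [← map_mul, ← hcU, Units.mul_inv, map_one]
  refine ⟨residue O y, fun h0 ↦ ?_, ?_⟩
  · rw [h0, zero_pow (by norm_num)] at hres
    have hcUres : residue O ↑cU⁻¹ ≠ 0 := fun h ↦ by
      rw [h, mul_zero] at hcinv; exact zero_ne_one hcinv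
    exact mul_ne_zero (hred ▸ hc₄) hcUres hres.symm
  · rw [hred]
    calc residue O ((V.localMinimalModel w).integralModel O).c₄
          = residue O ((V.localMinimalModel w).integralModel O).c₄ *
              (residue O c * residue O ↑cU⁻¹) := by rw [hcinv, mul_one]
      _ = residue O y ^ 4 * residue O c := by rw [hres]; ring

omit [V.IsElliptic] in
/-- **`c₆` of the reduction, up to sixth powers** (Silverman *AEC* VII.1.3(b), `c₆ ↦ u⁻⁶c₆`). Let
`V/F` be good at `w` with `c₆(Ẽ_w) ≠ 0`, and suppose `η·c₆(V) = s⁶·c` in `F_w` with `η, c ∈ O_w`,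
`η ≡ 1`, `c ≢ 0 (mod 𝔪_w)`. Then **`c₆(Ẽ_w) = t⁶·c̄` for some `t ∈ k_w`, `t ≠ 0`.**
[cite: SilvermanAEC2009, Prop. VII.1.3(b), p. 186] -/
theorem exists_reductionAt_c₆_eq_pow_six_mul (hgood : V.HasGoodReductionAt w)
    (hc₆ : (V.reductionAt w).c₆ ≠ 0) {s : w.adicCompletion F}
    {η c : w.adicCompletionIntegers F} (hη : residue _ η = 1) (hc : residue _ c ≠ 0)
    (hfac : algebraMap _ (w.adicCompletion F) η * algebraMap F (w.adicCompletion F) V.c₆ =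
      s ^ 6 * algebraMap _ (w.adicCompletion F) c) :
    ∃ t : ResidueField (w.adicCompletionIntegers F), t ≠ 0 ∧
      (V.reductionAt w).c₆ = t ^ 6 * residue _ c := by
  let O := w.adicCompletionIntegers F
  let Fw := w.adicCompletion F
  have hg : (V.localMinimalModel w).HasGoodReduction O := hgood
  haveI := hg.toIsMinimal
  obtain ⟨C, hC⟩ : ∃ C : VariableChange Fw, C • V.baseChange Fw = V.localMinimalModel w := ⟨_, rfl⟩
  have hXc₆ : (V.localMinimalModel w).c₆ = (↑C.u⁻¹ : Fw) ^ 6 * algebraMap F Fw V.c₆ := by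
    rw [← hC, variableChange_c₆, baseChange, map_c₆]
  have hIc : algebraMap O Fw ((V.localMinimalModel w).integralModel O).c₆ = (V.localMinimalModel w).c₆ :=
    integralModel_c₆_eq O _
  have hred : (V.reductionAt w).c₆ = residue O ((V.localMinimalModel w).integralModel O).c₆ := by
    show (((V.localMinimalModel w).integralModel O).map (residue O)).c₆ = _
    rw [map_c₆]
  obtain ⟨cU, hcU⟩ : IsUnit c := by
    have h := hc
    rwa [Ne, residue_eq_zero_iff, mem_maximalIdeal, mem_nonunits_iff, not_not] at h
  -- `r = s / u` satisfies `r⁶ = η · c₆(X) · c⁻¹`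
  have hr6 : (s * (↑C.u⁻¹ : Fw)) ^ 6 =
      algebraMap O Fw (η * ((V.localMinimalModel w).integralModel O).c₆ * ↑cU⁻¹) := by
    have h1 : (s * (↑C.u⁻¹ : Fw)) ^ 6 * algebraMap O Fw c =
        algebraMap O Fw (η * ((V.localMinimalModel w).integralModel O).c₆) := by
      rw [map_mul, hIc, hXc₆]
      linear_combination (-(↑C.u⁻¹ : Fw) ^ 6) * hfac
    have hcc : c * ↑cU⁻¹ = 1 := by rw [← hcU, Units.mul_inv]
    calc (s * (↑C.u⁻¹ : Fw)) ^ 6 = (s * (↑C.u⁻¹ : Fw)) ^ 6 * algebraMap O Fw (c * ↑cU⁻¹) := by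
          rw [hcc, map_one, mul_one]
      _ = _ := by rw [map_mul, ← mul_assoc, h1, ← map_mul]
  -- `r` is integral over the integrally closed `O`, hence in `O`
  have hrint : IsIntegral O (s * (↑C.u⁻¹ : Fw)) := by
    refine ⟨Polynomial.X ^ 6 - Polynomial.C (η * ((V.localMinimalModel w).integralModel O).c₆ * ↑cU⁻¹),
      Polynomial.monic_X_pow_sub_C _ (by norm_num), ?_⟩
    rw [Polynomial.eval₂_sub, Polynomial.eval₂_X_pow, Polynomial.eval₂_C, hr6, sub_self]
  obtain ⟨y, hy⟩ := IsIntegrallyClosed.isIntegral_iff.mp hrint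
  have hy6 : y ^ 6 = η * ((V.localMinimalModel w).integralModel O).c₆ * ↑cU⁻¹ :=
    IsFractionRing.injective O Fw (by rw [map_pow, hy, hr6])
  have hres : residue O y ^ 6 =
      residue O ((V.localMinimalModel w).integralModel O).c₆ * residue O ↑cU⁻¹ := by
    rw [← map_pow, hy6, map_mul, map_mul, hη, one_mul]
  have hcinv : residue O c * residue O ↑cU⁻¹ = 1 := by
    rw [← map_mul, ← hcU, Units.mul_inv, map_one]
  refine ⟨residue O y, fun h0 ↦ ?_, ?_⟩
  · rw [h0, zero_pow (by norm_num)] at hres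
    have hcUres : residue O ↑cU⁻¹ ≠ 0 := fun h ↦ by
      rw [h, mul_zero] at hcinv; exact zero_ne_one hcinv
    exact mul_ne_zero (hred ▸ hc₆) hcUres hres.symm
  · rw [hred]
    calc residue O ((V.localMinimalModel w).integralModel O).c₆
          = residue O ((V.localMinimalModel w).integralModel O).c₆ *
              (residue O c * residue O ↑cU⁻¹) := by rw [hcinv, mul_one]
      _ = residue O y ^ 6 * residue O c := by rw [hres]; ring

/-! ### The non-vanishing hypotheses at residue characteristic `p ≥ 5` -/

variable {p : ℕ}

/-- `(1728 : k_w) ≠ 0` at a place of norm `p ≥ 5`. [folklore] -/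
theorem cast_1728_residueField_ne_zero (hp : p.Prime) (hp5 : 5 ≤ p)
    (hN : Ideal.absNorm w.asIdeal = p) :
    (1728 : ResidueField (w.adicCompletionIntegers F)) ≠ 0 := by
  haveI := Fintype.ofFinite (ResidueField (w.adicCompletionIntegers F))
  obtain ⟨hchar, -⟩ := SpecialJ.ringChar_eq_of_natCard_eq
    (k := ResidueField (w.adicCompletionIntegers F)) hp
    (natCard_residueField_adicCompletionIntegers_eq_of_absNorm w hN)
  have h2 : ringChar (ResidueField (w.adicCompletionIntegers F)) ≠ 2 := by rw [hchar]; omega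
  have h3 : ringChar (ResidueField (w.adicCompletionIntegers F)) ≠ 3 := by rw [hchar]; omega
  obtain ⟨h2', h3'⟩ := SpecialJ.two_ne_zero_and_three_ne_zero h2 h3
  rw [show (1728 : ResidueField (w.adicCompletionIntegers F)) = 2 ^ 6 * 3 ^ 3 by norm_num]
  exact mul_ne_zero (pow_ne_zero _ h2') (pow_ne_zero _ h3')

/-- **`w(j − 1728) < 1` at a good place of norm `p ≥ 5` ⟹ `c₄(Ẽ_w) ≠ 0`**: `j̃ = 1728` gives
`c₆(Ẽ_w) = 0` (`SpecialJ.j_eq_iff_c₆_eq_zero`), so `c₄(Ẽ_w)³ = 1728·Δ̃ ≠ 0`. [folklore] -/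
theorem reductionAt_c₄_ne_zero_of_valuation_j_sub_lt_one (hp : p.Prime) (hp5 : 5 ≤ p)
    (hN : Ideal.absNorm w.asIdeal = p) (hgood : V.HasGoodReductionAt w)
    (hj : w.valuation F (V.j - 1728) < 1) : (V.reductionAt w).c₄ ≠ 0 := by
  haveI : (V.reductionAt w).IsElliptic := isElliptic_reductionAt hgood
  have hc₆ : (V.reductionAt w).c₆ = 0 :=
    (SpecialJ.j_eq_iff_c₆_eq_zero _).mp (reductionAt_j_eq_of_valuation_lt_one V w hgood hj)
  have hrel := (V.reductionAt w).c_relation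
  rw [hc₆, zero_pow two_ne_zero, sub_zero] at hrel
  intro h0
  rw [h0, zero_pow three_ne_zero] at hrel
  exact mul_ne_zero (cast_1728_residueField_ne_zero w hp hp5 hN)
    (V.reductionAt w).isUnit_Δ.ne_zero hrel

/-- **`w(j) < 1` at a good place of norm `p ≥ 5` ⟹ `c₆(Ẽ_w) ≠ 0`**: `j̃ = 0` gives `c₄(Ẽ_w) = 0`
(`reductionAt_c₄_eq_zero_of_valuation_j_lt_one`, gen 3), so `c₆(Ẽ_w)² = −1728·Δ̃ ≠ 0`. [folklore] -/
theorem reductionAt_c₆_ne_zero_of_valuation_j_lt_one (hp : p.Prime) (hp5 : 5 ≤ p)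
    (hN : Ideal.absNorm w.asIdeal = p) (hgood : V.HasGoodReductionAt w)
    (hj : w.valuation F V.j < 1) : (V.reductionAt w).c₆ ≠ 0 := by
  haveI : (V.reductionAt w).IsElliptic := isElliptic_reductionAt hgood
  have hc₄ : (V.reductionAt w).c₄ = 0 := reductionAt_c₄_eq_zero_of_valuation_j_lt_one V w hgood hj
  have hrel := (V.reductionAt w).c_relation
  rw [hc₄, zero_pow three_ne_zero, zero_sub] at hrel
  intro h0
  rw [h0, zero_pow two_ne_zero, neg_zero] at hrel
  exact mul_ne_zero (cast_1728_residueField_ne_zero w hp hp5 hN)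
    (V.reductionAt w).isUnit_Δ.ne_zero hrel

end Local

end Summit.BirchSwinnertonDyer.Rank1Residual.Additive

end
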